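import Mathlib
import HarnessLib
import Literature.Geometry.Lorentzian.KerrConvergence

/-!
# Route StarvedNecks — crux `FutureOrientedOfSeamed` (stmt-FinalStateConjecture-17576), line `Sketch`:
# stub `stub_pointwiseDeviation`

Order-zero pointwise extraction from the truncated `Cᵏ` deviation: if the `C⁰` deviation of a chart
`Ψ : B.domain → 𝓢` on the truncated slab `{t = τ, r ≤ ρ}` of a model background `B` is `≤ δ`
(as an extended real, `δ ≥ 0`), then `‖(Ψ^* g − g_B)(x)‖ ≤ δ` at every point `x` of that slab.

[folklore]
-/

noncomputable section

set_option linter.dupNamespace false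
-- instance search through nested operator types `E4 →L[ℝ] E4 →L[ℝ] ℝ`
set_option maxSynthPendingDepth 3

open Set Filter Topology Function
open scoped Manifold ContDiff ENNReal Topology
open Literature.Geometry.Lorentzian

namespace Summit.FinalStateConjecture.FinalStateConjecture.Theorems.FutureOrientedOfSeamed.ClockDualityRays

/-- **Pointwise `C⁰` bound from the truncated `C⁰` deviation.** For a chart `Ψ : B.domain → 𝓢`
on a model background `B`, if `truncDeviationCk B Ψ 0 ρ τ ≤ δ` with `0 ≤ δ`, then at every point
`x` of the truncated slab `{t = τ, r ≤ ρ}` the metric deviation satisfies `‖(Ψ^* g − g_B)(x)‖ ≤ δ`: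
the `m = 0` term of the `Cᵏ` sup norm at `x` is `‖D⁰(deviationExtend)(x)‖ = ‖deviation x‖`
(`norm_iteratedFDeriv_zero`, `deviationExtend_coe`). DHRT arXiv:2104.08222, §1 (pointwise norms of
the metric deviation); Bartnik, CPAM 39 (1986), (1.3). [folklore] -/
theorem stub_pointwiseDeviation (𝓢 : Spacetime.{0} 4) (B : ModelBackground) (Ψ : B.domain → 𝓢.carrier)
    {ρ τ δ : ℝ} (hδ : 0 ≤ δ) (h : 𝓢.truncDeviationCk B Ψ 0 ρ τ ≤ ENNReal.ofReal δ)
    (x : B.domain) (hx : x ∈ B.truncTimeSlab ρ τ) :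
    ‖𝓢.deviation B Ψ x‖ ≤ δ := by
  -- adapted from `Summit.FinalStateConjecture.FinalStateConjecture.Theorems.`
  -- `norm_deviation_le_of_truncDeviationCk_le` (EIHFluxBalanceInertialRecessionRechartHoleCausal)
  have hmem : x.1 ∈ Subtype.val '' B.truncTimeSlab ρ τ := mem_image_of_mem _ hx
  have h1 := enorm_iteratedFDeriv_le_supCkENorm (le_refl 0) hmem (𝓢.deviationExtend B Ψ)
  have h2 : ‖iteratedFDeriv ℝ 0 (𝓢.deviationExtend B Ψ) x.1‖ₑ ≤ ENNReal.ofReal δ := h1.trans h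
  rw [← ofReal_norm, norm_iteratedFDeriv_zero, Spacetime.deviationExtend_coe,
    ENNReal.ofReal_le_ofReal_iff hδ] at h2
  exact h2

end Summit.FinalStateConjecture.FinalStateConjecture.Theorems.FutureOrientedOfSeamed.ClockDualityRays

end
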